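import Literature.Computability.QuantumComplexity.ForrelationThreeFoldTables
import Literature.Computability.QuantumComplexity.ForrelationIdleWires
import Literature.Computability.QuantumComplexity.ForrelationDirectSum
import HarnessLib

/-!
# The one-control-wire gadget: the SIGN of `Φ` as a 3-fold forrelation (Aaronson–Ambainis, Prop. 6)

Topic `Literature/Computability/QuantumComplexity`. Aaronson–Ambainis (SIAM J. Comput. 47 (2018),
§3.2, Prop. 6) decide `k`-fold FORRELATION with `⌈k/2⌉` queries by a Hadamard test: a control qubit
in `|+⟩`, the first half of the Forrelation circuit `H → U_{f₁} → H → ⋯` run conditioned on the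
control being `|0⟩`, the second half (read backwards) conditioned on `|1⟩`, and a final Hadamard on
the control; the control reads `0` with probability EXACTLY `(1 + Φ)/2`, which sees the sign of `Φ`.

This file is the combinatorial heart of the white-box (`PromiseBQP`) version at `k = 2` in the tree's
framework of phase-query families (`PhaseQuery*.lean`: uniform Clifford+T families whose return
amplitude is a `k`-fold forrelation `kForrelationValue` of polynomial-time phase predicates, with FULL
Hadamard layers `H^{⊗W}` on all active wires). With one extra CONTROL wire `c` (the last coordinate)
and three phase layers on `m + 1` wires,

* `ctl g (x, c) = c ∧ g(x)` (phase only on the control branch), `dat g (x, c) = g(x)`;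
* **`kForrelationValue_ctl`**: `Φ₃(ctl g₁, dat g₂, ctl g₃) = ((-1)^{g₂(0)} + Φ₃(g₁, g₂, g₃)) / 2` — the
  path sum over the three control bits `c₁ c₂ c₃` with the full-layer twists `(-1)^{c₁c₂ + c₂c₃}`
  collapses to the two diagonal paths `c₁ = c₃` (the middle layer ignores the control), the constant
  path contributing `(-1)^{g₂(0)}` (`H|+⟩ = |0⟩`);
* **`kForrelationValue_bent`**: `Φ₃(g₁, g₂, q) = Φ₂(g₁, g₂ ⊕ q)` for a SELF-DUAL BENT `q`
  (`IsSelfDualBent`: `W_{(-1)^q} = 2^{m/2} (-1)^q`, i.e. `H^{⊗m} D_q |+⟩ = D_q |+⟩`);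
* `ipHalf t`, the inner product `⟨u, v⟩` of the two halves of `u ++ v ∈ {0,1}^{t+t}`, is self-dual
  bent (`isSelfDualBent_ipHalf`; Dillon / Rothaus, the Maiorana–McFarland form with `π = id`);
* **`kForrelationValue_gadget`**: with `g₁ = a ⊕ b(0)`, `g₂ = b ⊕ q`, `g₃ = q` the amplitude is
  `(-1)^{b(0)} (1 + Φ(a, b)) / 2`, of modulus `(1 + Φ(a,b))/2` (`abs_gadget`) — the Hadamard-test
  statistics of Prop. 6, here as ONE amplitude of a full-layer circuit.

Pure finite Fourier analysis over `ℝ`; no machines here (they are in `SignedForrelationMem*.lean`).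

## References

* S. Aaronson, A. Ambainis, *Forrelation: a problem that optimally separates quantum from classical
  computing*, SIAM J. Comput. 47 (2018) 982–1038, §3.2 Prop. 6 (arXiv:1411.5729, pp. 11–12)
  [AaronsonAmbainis2018].
* O. S. Rothaus, *On "bent" functions*, J. Combin. Theory Ser. A 20 (1976) 300–305 (the inner
  product is bent and self-dual); R. O'Donnell, *Analysis of Boolean Functions*, CUP 2014, §1.4
  [ODonnell2014].
-/

noncomputable section

namespace Literature.Computability.QuantumComplexity

namespace SgnForrMem

open Finset DerivativeWalsh BuzetChailloux Simon

variable {m n : ℕ}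

/-! ### Sums over one more coordinate; controlled predicates -/

/-- A sum over `{0,1}^{m+1}` is a sum over the first `m` coordinates and the last one. [folklore] -/
theorem sum_snoc (F : (Fin (m + 1) → Bool) → ℝ) :
    ∑ X, F X = ∑ x : Fin m → Bool, ∑ c : Bool, F (Fin.snoc x c) := by
  rw [← (Fin.snocEquiv fun _ : Fin (m + 1) => Bool).sum_comp, Fintype.sum_prod_type, Finset.sum_comm]
  rfl

/-- **The controlled predicate** `ctl g (x, c) = c ∧ g(x)`: the phase `(-1)^{g}` on the branch where the
control wire (the last coordinate) is set. [cite: AaronsonAmbainis2018, §3.2 Prop. 6] -/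
def ctl (g : (Fin m → Bool) → Bool) (X : Fin (m + 1) → Bool) : Bool := X (Fin.last m) && g (Fin.init X)

/-- The uncontrolled predicate `dat g (x, c) = g(x)` (ignores the control wire). [cite: AaronsonAmbainis2018, §3.2 Prop. 6] -/
def dat (g : (Fin m → Bool) → Bool) (X : Fin (m + 1) → Bool) : Bool := g (Fin.init X)

/-- `ctl g` on `(x, c)`. [folklore] -/
@[simp] theorem ctl_snoc (g : (Fin m → Bool) → Bool) (x : Fin m → Bool) (c : Bool) :
    ctl g (Fin.snoc x c) = (c && g x) := by
  simp [ctl, Fin.init_snoc, Fin.snoc_last]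

/-- `dat g` on `(x, c)`. [folklore] -/
@[simp] theorem dat_snoc (g : (Fin m → Bool) → Bool) (x : Fin m → Bool) (c : Bool) :
    dat g (Fin.snoc x c) = g x := by
  simp [dat, Fin.init_snoc]

/-- `signOf false = 1`. [folklore] -/
@[simp] theorem signOf_false : signOf false = 1 := rfl

/-- `signOf true = -1`. [folklore] -/
@[simp] theorem signOf_true : signOf true = -1 := rfl

/-- `signOf (true ∧ b) = signOf b`. [folklore] -/
@[simp] theorem signOf_true_and (b : Bool) : signOf (true && b) = signOf b := by cases b <;> rfl

/-- The column sum `S(y) = ∑ₓ (-1)^{x·y}` (`= 2^m [y = 0]`). [cite: ODonnell2014, §1.4] -/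
def colSum (y : Fin m → Bool) : ℝ := ∑ x, twist x y

/-- `S(y) = 2^m` if `y = 0`, else `0`. [cite: ODonnell2014, §1.4] -/
theorem colSum_eq (y : Fin m → Bool) : colSum y = if y = (fun _ => false) then (2 : ℝ) ^ m else 0 := by
  unfold colSum
  rw [show (∑ x, twist x y) = ∑ x, twist y x from sum_congr rfl fun x _ => twist_comm x y]
  exact sum_twist y

/-- **The Walsh transform of a controlled predicate**: `W_{ctl g}(y, c') = S(y) + (-1)^{c'} W_g(y)`.
[cite: AaronsonAmbainis2018, §3.2 Prop. 6] -/
theorem W_ctl (g : (Fin m → Bool) → Bool) (y : Fin m → Bool) (c' : Bool) :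
    W (fun X => signOf (ctl g X)) (Fin.snoc y c') = colSum y + signOf c' * W (fun x => signOf (g x)) y := by
  unfold W colSum
  rw [sum_snoc, mul_sum, ← sum_add_distrib]
  refine sum_congr rfl fun x _ => ?_
  rw [Fintype.sum_bool]
  simp only [ctl_snoc, twist_snoc, Bool.false_and, signOf_false, Bool.true_and]
  cases c' <;> simp <;> ring

/-! ### The 3-fold forrelation through Walsh transforms -/

/-- `Φ₃(f₀,f₁,f₂) = 2^{-2n} ∑_y (-1)^{f₁(y)} W_{f₀}(y) W_{f₂}(y)`. [cite: AaronsonAmbainis2018, §1.1.3] -/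
theorem kForrelationValue_three_eq_W (f₀ f₁ f₂ : (Fin n → Bool) → Bool) :
    kForrelationValue ![f₀, f₁, f₂] = (Real.sqrt (2 ^ (4 * n)))⁻¹ *
      ∑ y, signOf (f₁ y) * W (fun x => signOf (f₀ x)) y * W (fun z => signOf (f₂ z)) y := by
  rw [kForrelationValue_fin_three, ← sum_three_eq_sum_mul_W_mul_W]
  simp

/-- `√(2^{4n}) = 2^{2n}`. [folklore] -/
theorem sqrt_two_pow_four_mul (n : ℕ) : Real.sqrt ((2 : ℝ) ^ (4 * n)) = 2 ^ (2 * n) := by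
  rw [show (2 : ℝ) ^ (4 * n) = (2 ^ (2 * n)) ^ 2 by rw [← pow_mul]; ring_nf, Real.sqrt_sq (by positivity)]

/-- The constant path: `∑_y (-1)^{g(y)} S(y)² = 2^{2m} (-1)^{g(0)}`. [folklore] -/
theorem sum_signOf_mul_colSum_sq (g : (Fin m → Bool) → Bool) :
    ∑ y, signOf (g y) * (colSum y * colSum y) = (2 : ℝ) ^ (2 * m) * signOf (g fun _ => false) := by
  rw [Finset.sum_eq_single (fun _ : Fin m => false)]
  · rw [colSum_eq, if_pos rfl, two_mul, pow_add]; ring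
  · intro y _ hy; rw [colSum_eq, if_neg hy]; ring
  · intro h; exact absurd (mem_univ _) h

/-- **The control-wire lemma** (the one-control-qubit path sum of Prop. 6 in full Hadamard layers):
`Φ₃(ctl g₁, dat g₂, ctl g₃) = ((-1)^{g₂(0)} + Φ₃(g₁, g₂, g₃)) / 2`.
[cite: AaronsonAmbainis2018, §3.2 Prop. 6] -/
theorem kForrelationValue_ctl (g₁ g₂ g₃ : (Fin m → Bool) → Bool) :
    kForrelationValue ![ctl g₁, dat g₂, ctl g₃] = (signOf (g₂ fun _ => false) + kForrelationValue ![g₁, g₂, g₃]) / 2 := by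
  rw [kForrelationValue_three_eq_W, kForrelationValue_three_eq_W, sum_snoc]
  simp only [dat_snoc, W_ctl, Fintype.sum_bool, signOf_true, signOf_false]
  have e : ∀ y : Fin m → Bool,
      signOf (g₂ y) * (colSum y + -1 * W (fun x => signOf (g₁ x)) y) * (colSum y + -1 * W (fun z => signOf (g₃ z)) y) +
        signOf (g₂ y) * (colSum y + 1 * W (fun x => signOf (g₁ x)) y) * (colSum y + 1 * W (fun z => signOf (g₃ z)) y) =
      2 * (signOf (g₂ y) * (colSum y * colSum y)) +
        2 * (signOf (g₂ y) * W (fun x => signOf (g₁ x)) y * W (fun z => signOf (g₃ z)) y) := fun y => by ring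
  rw [sum_congr rfl fun y _ => e y, sum_add_distrib, ← mul_sum, ← mul_sum, sum_signOf_mul_colSum_sq,
    show 4 * (m + 1) = 4 * m + 4 by ring, pow_add, Real.sqrt_mul (by positivity),
    show Real.sqrt ((2 : ℝ) ^ 4) = 4 by rw [show (2 : ℝ) ^ 4 = 4 ^ 2 by norm_num, Real.sqrt_sq (by norm_num)],
    sqrt_two_pow_four_mul]
  have h : (2 : ℝ) ^ (2 * m) ≠ 0 := by positivity
  field_simp
  ring

/-! ### Self-dual bent absorbers -/

/-- **Self-dual bent** (unnormalised): `W_{(-1)^q}(y) = 2^{m/2} (-1)^{q(y)}` for all `y`, i.e.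
`H^{⊗m} D_q |+⟩ = D_q |+⟩`. [cite: ODonnell2014, §1.4] -/
def IsSelfDualBent (q : (Fin m → Bool) → Bool) : Prop :=
  ∀ y, W (fun x => signOf (q x)) y = Real.sqrt (2 ^ m) * signOf (q y)

/-- `Φ₂(f, g) = 2^{-3n/2} ∑_y (-1)^{g(y)} W_f(y)`. [cite: AaronsonAmbainis2018, §1.1.1] -/
theorem forrelation_eq_sum_W (f g : (Fin n → Bool) → Bool) :
    forrelation f g = (Real.sqrt (2 ^ (3 * n)))⁻¹ * ∑ y, signOf (g y) * W (fun x => signOf (f x)) y := by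
  rw [← phi_signOf, phi_eq_fsum, fsum_eq_sum_mul_W']

/-- **Bent absorption**: a self-dual bent LAST layer turns a 3-fold forrelation into a 2-fold one,
`Φ₃(g₁, g₂, q) = Φ₂(g₁, g₂ ⊕ q)` (`⟨+| D_q H = ⟨+| D_q`). [cite: AaronsonAmbainis2018, §3.2] -/
theorem kForrelationValue_bent (g₁ g₂ q : (Fin m → Bool) → Bool) (hq : IsSelfDualBent q) :
    kForrelationValue ![g₁, g₂, q] = forrelation g₁ (fun y => xor (g₂ y) (q y)) := by
  rw [kForrelationValue_three_eq_W, forrelation_eq_sum_W]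
  have e : ∀ y : Fin m → Bool, signOf (g₂ y) * W (fun x => signOf (g₁ x)) y * W (fun z => signOf (q z)) y =
      Real.sqrt (2 ^ m) * (signOf (xor (g₂ y) (q y)) * W (fun x => signOf (g₁ x)) y) := fun y => by
    rw [hq y, signOf_xor]; ring
  rw [sum_congr rfl fun y _ => e y, ← mul_sum, ← mul_assoc,
    show (4 * m) = m + 3 * m by ring, pow_add, Real.sqrt_mul (by positivity)]
  have h1 : Real.sqrt ((2 : ℝ) ^ m) ≠ 0 := by positivity
  have h3 : Real.sqrt ((2 : ℝ) ^ (3 * m)) ≠ 0 := by positivity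
  field_simp

/-! ### The inner product of the two halves is self-dual bent -/

/-- **The inner product of the two halves**: `ipHalf t (u ++ v) = ⟨u, v⟩ = ∑ᵢ uᵢ vᵢ mod 2` on
`{0,1}^{t+t}` (the Maiorana–McFarland bent function with the identity permutation). [folklore] -/
def ipHalf (t : ℕ) (w : Fin (t + t) → Bool) : Bool :=
  decide (Odd (univ.filter fun i : Fin t => w (Fin.castAdd t i) && w (Fin.natAdd t i)).card)

/-- `(-1)^{[odd n]} = (-1)^n`. [folklore] -/
theorem signOf_decide_odd (n : ℕ) : signOf (decide (Odd n)) = (-1 : ℝ) ^ n := by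
  rcases Nat.even_or_odd n with h | h
  · rw [h.neg_one_pow, decide_eq_false (Nat.not_odd_iff_even.2 h)]; rfl
  · rw [h.neg_one_pow, decide_eq_true h]; rfl

/-- `(-1)^{ipHalf (u ++ v)} = (-1)^{u·v}`. [folklore] -/
theorem signOf_ipHalf_append {t : ℕ} (u v : Fin t → Bool) : signOf (ipHalf t (Fin.append u v)) = twist u v := by
  rw [ipHalf, signOf_decide_odd, twist_eq_neg_one_pow]
  simp only [Fin.append_left, Fin.append_right]

/-- `ipHalf` vanishes at `0`. [folklore] -/
theorem ipHalf_zero (t : ℕ) : ipHalf t (fun _ => false) = false := by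
  simp [ipHalf]

/-- `√(2^{t+t}) = 2^t`. [folklore] -/
theorem sqrt_two_pow_add_self (t : ℕ) : Real.sqrt ((2 : ℝ) ^ (t + t)) = 2 ^ t := by
  rw [show (2 : ℝ) ^ (t + t) = (2 ^ t) ^ 2 by rw [← pow_mul]; ring_nf, Real.sqrt_sq (by positivity)]

/-- **The inner product of the two halves is self-dual bent**: `W_{(-1)^{⟨u,v⟩}}(u', v') = 2^t (-1)^{⟨u',v'⟩}`
(sum over `v` first: `∑_v (-1)^{v·(u ⊕ v')} = 2^t [u = v']`). [cite: ODonnell2014, §1.4] -/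
theorem isSelfDualBent_ipHalf (t : ℕ) : IsSelfDualBent (ipHalf t) := by
  intro y
  obtain ⟨⟨u', v'⟩, rfl⟩ := (Fin.appendEquiv t t).surjective y
  show W (fun x => signOf (ipHalf t x)) (Fin.append u' v') = Real.sqrt (2 ^ (t + t)) * signOf (ipHalf t (Fin.append u' v'))
  rw [W, sum_append, signOf_ipHalf_append, sqrt_two_pow_add_self]
  simp only [signOf_ipHalf_append, twist_append]
  have inner : ∀ u : Fin t → Bool, ∑ v : Fin t → Bool, twist u v * (twist u u' * twist v v') =
      twist u u' * if bxor u v' = (fun _ => false) then (2 : ℝ) ^ t else 0 := by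
    intro u
    rw [← sum_twist (bxor u v'), mul_sum]
    refine sum_congr rfl fun v _ => ?_
    rw [twist_comm (bxor u v') v, twist_bxor_right, twist_comm u v]
    ring
  simp only [inner]
  have key : ∀ u : Fin t → Bool, (twist u u' * if bxor u v' = (fun _ => false) then (2 : ℝ) ^ t else 0) =
      if u = v' then twist v' u' * 2 ^ t else 0 := by
    intro u
    by_cases h : u = v'
    · subst h
      rw [if_pos (by funext i; simp [bxor]), if_pos rfl]
    · rw [if_neg, if_neg h, mul_zero]
      intro e
      exact h (funext fun i => by have := congrFun e i; simpa [bxor] using this)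
  rw [sum_congr rfl fun u _ => key u, sum_ite_eq' univ v', if_pos (mem_univ _), twist_comm v' u']
  ring

/-! ### The gadget -/

/-- `|Φ(f,g)| ≤ 1`. [cite: AaronsonAmbainis2018, §1.1.3 (p. 5)] -/
theorem abs_forrelation_le_one (f g : (Fin n → Bool) → Bool) : |forrelation f g| ≤ 1 := by
  simpa [kForrelationValue_fin_two] using abs_kForrelationValue_le_one ![f, g]

/-- A constant shift of the first function multiplies `Φ` by its sign: `Φ(a ⊕ b₀, b) = (-1)^{b₀} Φ(a, b)`.
[cite: AaronsonAmbainis2018, §1.1.1] -/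
theorem forrelation_xor_const_left (a b : (Fin n → Bool) → Bool) (b₀ : Bool) :
    forrelation (fun x => xor (a x) b₀) b = signOf b₀ * forrelation a b := by
  unfold forrelation
  rw [mul_left_comm]
  congr 1
  rw [Finset.mul_sum]
  refine sum_congr rfl fun x _ => ?_
  rw [Finset.mul_sum]
  refine sum_congr rfl fun y _ => ?_
  rw [signOf_xor]
  ring

/-- **The gadget** (AA Prop. 6 as one amplitude). For a self-dual bent `q` with `q(0) = 0`, the 3-fold
forrelation on `m + 1` wires of `(c ∧ (a ⊕ b(0)), b ⊕ q, c ∧ q)` is `(-1)^{b(0)} (1 + Φ(a,b)) / 2`.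
[cite: AaronsonAmbainis2018, §3.2 Prop. 6] -/
theorem kForrelationValue_gadget (a b q : (Fin m → Bool) → Bool) (hq : IsSelfDualBent q) (hq0 : q (fun _ => false) = false) :
    kForrelationValue ![ctl (fun x => xor (a x) (b fun _ => false)), dat (fun y => xor (b y) (q y)), ctl q] =
      signOf (b fun _ => false) * (1 + forrelation a b) / 2 := by
  rw [kForrelationValue_ctl, kForrelationValue_bent _ _ _ hq, hq0, Bool.xor_false]
  have e : (fun y => xor (xor (b y) (q y)) (q y)) = b := funext fun y => by rw [Bool.xor_assoc, Bool.xor_self, Bool.xor_false]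
  rw [e, forrelation_xor_const_left]
  ring

/-- The modulus of the gadget amplitude is EXACTLY `(1 + Φ(a,b))/2` — the acceptance statistics of the
Hadamard test. [cite: AaronsonAmbainis2018, §3.2 Prop. 6] -/
theorem abs_gadget (a b : (Fin n → Bool) → Bool) (b₀ : Bool) :
    |signOf b₀ * (1 + forrelation a b) / 2| = (1 + forrelation a b) / 2 := by
  have h1 : -1 ≤ forrelation a b := (abs_le.1 (abs_forrelation_le_one a b)).1
  rw [abs_div, abs_mul, abs_signOf, one_mul, abs_of_nonneg (by linarith : 0 ≤ 1 + forrelation a b), abs_of_pos (by norm_num : (0:ℝ) < 2)]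

end SgnForrMem

end Literature.Computability.QuantumComplexity

end
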